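import Summits.CriticalPhenomena.CardyFormulaZ2.Theorems.CardyComplexConeEdgePrecompactUFRSFailureStructure
import Summits.CriticalPhenomena.CardyFormulaZ2.Theorems.CardyComplexConeEdgePrecompactUFRSArms
import Literature.Probability.Percolation.AnnulusCrossingBound
import Literature.Probability.Percolation.Z2HalfPlaneThreeArm

/-!
# Strands crossing an annulus are open and dual crossings of the completed configuration
(line `qkz-strip-boundary-arm` of crux `CardyComplexCone.EdgePrecompact`, stmt-CriticalPhenomena-11387;
items 3–5 of the road map for the uniform forward response stability "UFRS", module docstring of
`Theorems/CardyComplexConeEdgePrecompactUniformForwardResponseStability.lean`: the bridge from the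
strands of `…UFRSStrands.lean` / `…UFRSLastDeparture.lean` to the crossing events of the tree's
RSW estimates, and a CORRECTION of the road map's arm accounting)

## The bridge (proved here)

`exists_orbitArms` (`…UFRSStrands.lean`) attaches to every stretch `O c [i, j]` of an orbit of
Smirnov's successor map in ANY configuration `β` an open walk on its left and a dual walk on its
right. If the stretch starts within `r` of a point `z` and ends at distance `≥ R` from it, then,
stopping at the first exit (`exists_firstFarIndex`),
* `strand_mem_annulusOpenCrossing`: `β ∈ annulusOpenCrossing z δ r R` — the tree's open crossing
  of the Euclidean annulus `A(z; r, R)` at mesh `δ` (`AnnulusCrossingBound.lean`, the event of the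
  RSW bound `annulusOpenCrossing_half_le_holds`);
* `strand_mem_annulusDualCrossing`: `β ∈ annulusDualCrossing z δ (r + 2δ) (R - 2δ)` — the closed
  (dual-open) crossing, read on the right faces (a face is within `2δ` of its corners).
In UFRS `β = E.bcBondConfig ω` is the COMPLETED configuration: its open edges are `ω`-open or
wired, its closed domain edges `ω`-closed or touching the free arc (`ufrs_strandArms`), so these
are Dobrushin-boundary crossings; they are crossings of `ω` itself only in `3η`-deep annuli
(`collarAgreement`). `ufrs_collarStrand_crossings` records the typical use: a strand from a
collar corner (depth `< 3η`) to the ball `B(E.δ v, ρ)` (centre `2ρ`-deep) crosses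
`A(E.δ x; r, ρ - 3η - E.δ)` for every `r ≥ 0` (`far_of_cTgt_mem_ball`).

## Correction of the road map's items 3–5 (analysis of worker W-UFRS of lead c4; not formalised)

Notation of the road map: `S₀ = O₀ a [0, n]` (whisker `W₀ = O₀ a [0, m]`, run `R₀ = O₀ a (m, n]`),
`e = O₀ a m` the last synchronised corner at the collar point `z`, `R₁ = O₁ e (0, T]`.
1. "Three pairwise dart-disjoint strands at `cTgt e`" is FALSE in general: `R₁` may merge into
   `W₀` at collar discrepancy edges (`whiskerContact`, `run_whisker_trichotomy`), follow it, split
   off again, and in case (B) it returns to `R₀`. What holds (`ufrs_lastDeparture`,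
   `…UFRSLastDeparture.lean`): at the LAST contact `ζ = O₀ a i = O₁ e j` of the run with `S₀` the
   three strands `O₀ a [0, i)`, `O₀ a (i, n]`, `O₁ e (j, T]` are pairwise corner-disjoint, `cTgt ζ`
   is a collar discrepancy edge (if `j < T`), the first starts at `a`, the second ends in the ball,
   the third ends where the run ends (ball, or the exit corner of `E₁`; if `j = T` the run ends ON
   `S₀`: slipped return at `O₀ a n`, or `S₀` passes through the exit corner of `E₁`).
2. Case (B) topology (the bigon). Let the free arc `Q = O₁ e [1, j₁)` first meet `S₀` by a MERGE
   at the medial vertex `M` (predecessors `p ∈ S₀`, `p' ∈ Q` are the two opposite in-darts of `M`),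
   `P ⊂ S₀` the stretch from `cTgt e` to `M`. The closed curve `J = P · Q⁻¹` has NO cusps (the two
   out-darts of `cTgt e` are opposite, the two in-darts of `M` are opposite), so Hopf gives
   `turn(P) - turn(Q) = 2π s_J`; with the two local right angles the mismatch is
   `Δ = π (s_e + s_M + 2 s_J) ∈ {0, ±2π, ±4π}` and `Δ ≠ 0` iff `W₀` or the continuation after `M`
   lies INSIDE `J`; both start/end in the ball and avoid `J`, so `Δ ≠ 0` forces `J` to enclose the
   ball: `P ∪ Q` has diameter `≥ 2ρ - O(η)`. But `Q` alone may be SHORT (length `d ≪ ρ`, `P` going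
   around the ball): then `S₀` crosses `A(z; 2d, ρ/2)` FOUR times (`W₀` in, `P` out, `P` back,
   continuation out), pairwise disjointly (`S₀` is simple).
3. Hence the per-failure certificate is TWO-SCALE at one collar point: with `d` = extent of the
   third strand (free part of the run, or `Q`), three disjoint strand-crossings of
   `A(z; 4η, d/2)` AND (three or four) disjoint strand-crossings of `A(z; 2d, ρ/2)`, for some
   dyadic `d ∈ [8η, ρ/4]` (plus the one-scale case `d ≥ ρ/4`). With the flat three-arm bound
   (`Z2HalfPlane.real_threeArm_le`) and independence of disjoint annuli the cost per `η`-box is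
   `Σ_d C (η/d)^{1+α} C (d/ρ)^{1+α} ≤ C' log(ρ/η) (η/ρ)^{1+α}`, still summable against `L/η`
   boxes (rectifiable `∂D`). The ONE-scale event `A E w z (4η) (ρ/2)` of `ufrs_of_armDomination` is
   not implied by a failure; `A` must be such a two-scale union (and (Hm) re-verified for it).
4. Marked points need two scales as well: a failure whose collar point `z` is at distance `d` from
   a marked point costs three arms in `A(z; 4η, d/2)` times the Dobrushin-junction event in
   `A(b; 2d, ρ/2)` (one open and one dual arm not provided by the arcs: `Z2HalfPlane.real_twoArm_le`,
   probability `≲ d/ρ`): `Σ_d (d/η)(η/d)^{1+α}(d/ρ) → 0`. A marked-point event at scales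
   `(ρ/4, ρ)` alone is `O(1)` (the exploration revisits the `ρ/4`-neighbourhood of its endpoint with
   positive probability), so `B E w η ρ` must be rooted at scale `η`: e.g. "the `β₀`-strand through
   the exit corner of `shiftData E w` has both sides reaching distance `ρ/2`" (FACE, and the `j = T`
   exit case of item 1) and its INITIAL twin at `a`.
5. Strands → arms. The open arms of two corner-disjoint strands are NOT edge-disjoint in general
   (the two in-darts of an open edge both traverse it), nor are their dual arms; disjointness of
   same-colour arms — all that `zdDomArmEvent` and `Z2HalfPlane.threeArm` ask — needs the sector
   decomposition: corner-disjoint stretches of ONE configuration (use `strandSynthesis`) have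
   disjoint simple perturbed polylines (the tabulation of `MedialCycleTurning.lean` /
   `MedialPolygonSimple.lean`), `k` crossings cut the annulus into sectors
   (`PlaneTopology.not_three_arcs_touch`, cf. `MedialTraversalSectors.lean`), each strand has open
   on its left sector and dual on its right sector, and arms in different sectors are disjoint. In
   a flat WIRED collar three crossings always give three genuine arms (a boundary sector swallows
   only an OPEN arm; chain the colours), at a flat FREE collar likewise with colours swapped; at a
   general Jordan boundary fjords of `∂D` taint sectors (the device `card_le_of_separated_frontier_points`
   of `MedialTraversalSectors.lean` bounds tainted sectors by the modulus of `∂D`, useless with three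
   strands): this is the screening problem of item 6 of the road map, unchanged.

References: S. Smirnov, C. R. Acad. Sci. Paris 333 (2001), §2; B. Bollobás, O. Riordan,
*Percolation* (2006), Ch. 7, Lemma 4; G. Grimmett, *Percolation* (1999), §11.2, §11.8;
G. F. Lawler, O. Schramm, W. Werner, Electron. J. Probab. 7 (2002), Appendix A; H. Hopf,
Compositio Math. 2 (1935), Satz I.
-/

namespace Summit.CriticalPhenomena.CardyFormulaZ2.Cruxes.EdgePrecompact.QkzStripBoundaryArm

open MeasureTheory Filter Set Metric
open scoped Topology BigOperators Pointwise
open Literature.Probability.LatticeModels Literature.Probability.Percolation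
open Literature.Probability.RandomPlanarGeometry (DobrushinDomain)
open Summit.CriticalPhenomena.CardyFormulaZ2.Theses.CardyComplexCone

noncomputable section

/-! ## One step of an orbit moves vertex and face by at most one mesh -/

/-- Consecutive vertices of an orbit are equal or lattice neighbours: at distance `≤ |δ|`. -/
theorem dist_meshPoint_cornerOrbit_succ_le (β : BondConfig (Site 2)) (c : Site 2 × Fin 4) (δ : ℝ) (t : ℕ) :
    dist (meshPoint δ (cornerOrbit β c (t + 1)).1) (meshPoint δ (cornerOrbit β c t).1) ≤ |δ| := by
  show dist (meshPoint δ (nextCorner β (cornerOrbit β c t)).1) _ ≤ _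
  by_cases h : cTgt (cornerOrbit β c t) ∈ β
  · rw [nextCorner_of_mem h]
    exact (dist_meshPoint_add_cornerUnit_eq δ _ _).le
  · rw [nextCorner_of_not_mem h]
    simp

/-- Consecutive faces of an orbit are equal or dual neighbours: at distance `≤ |δ|`. -/
theorem dist_meshPoint_cFace_cornerOrbit_succ_le (β : BondConfig (Site 2)) (c : Site 2 × Fin 4) (δ : ℝ) (t : ℕ) :
    dist (meshPoint δ (cFace (cornerOrbit β c (t + 1)))) (meshPoint δ (cFace (cornerOrbit β c t))) ≤ |δ| := by
  show dist (meshPoint δ (cFace (nextCorner β (cornerOrbit β c t)))) _ ≤ _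
  by_cases h : cTgt (cornerOrbit β c t) ∈ β
  · rw [cFace_nextCorner_of_mem h]
    simp
  · rw [cFace_nextCorner_of_not_mem h, Literature.Probability.LatticeModels.faceAt_succ_eq]
    exact (dist_meshPoint_add_cornerUnit_eq δ _ _).le

/-- The face of a corner is within `2δ` of its vertex. -/
theorem dist_meshPoint_cFace_le {δ : ℝ} (hδ : 0 ≤ δ) (p : Site 2 × Fin 4) :
    dist (meshPoint δ (cFace p)) (meshPoint δ p.1) ≤ 2 * δ := by
  rw [dist_comm]
  exact dist_meshPoint_le_of_isCorner hδ (isCorner_cFace p)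

/-! ## Stopping at the first exit -/

/-- **First far index.** If a real sequence is `≥ R` at some index `j ≥ i`, it has a FIRST index
`t ∈ [i, j]` at which it is `≥ R`; before `t` (from `i` on) it is `< R`. -/
theorem exists_firstFarIndex (g : ℕ → ℝ) (R : ℝ) {i j : ℕ} (hij : i ≤ j) (hj : R ≤ g j) :
    ∃ t, i ≤ t ∧ t ≤ j ∧ R ≤ g t ∧ ∀ s, i ≤ s → s < t → g s < R := by
  classical
  have hex : ∃ t, i ≤ t ∧ R ≤ g t := ⟨j, hij, hj⟩
  refine ⟨Nat.find hex, (Nat.find_spec hex).1, Nat.find_min' hex ⟨hij, hj⟩, (Nat.find_spec hex).2,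
    fun s his hst => ?_⟩
  by_contra hge
  exact Nat.find_min hex hst ⟨his, not_lt.1 hge⟩

/-! ## The open crossing on the left of a strand -/

/-- **A strand crossing an annulus is an open crossing of its configuration.** For any
configuration `β`, corner `c`, mesh `δ ≥ 0` and stretch `O c [i, j]` of the orbit whose vertex at
time `i` is within `r ≤ R` of `z` and whose vertex at time `j` is at distance `≥ R` from `z`:
`β ∈ annulusOpenCrossing z δ r R` (the left vertices up to the first exit form an open walk from
the `r`-ball to distance `≥ R` through sites within `R + δ` of `z`). -/
theorem strand_mem_annulusOpenCrossing (β : BondConfig (Site 2)) (c : Site 2 × Fin 4) {δ r R : ℝ}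
    (hδ : 0 ≤ δ) (hrR : r ≤ R) {z : ℂ} {i j : ℕ} (hij : i ≤ j)
    (hi : dist (meshPoint δ (cornerOrbit β c i).1) z ≤ r) (hj : R ≤ dist (meshPoint δ (cornerOrbit β c j).1) z) :
    β ∈ annulusOpenCrossing z δ r R := by
  obtain ⟨t, hit, -, hRt, hbefore⟩ :=
    exists_firstFarIndex (fun s => dist (meshPoint δ (cornerOrbit β c s).1) z) R hij hj
  obtain ⟨W, hWs, hWe⟩ := exists_leftWalk β c i t hit
  rw [mem_annulusOpenCrossing_iff]
  refine ⟨(cornerOrbit β c i).1, hi, (cornerOrbit β c t).1, hRt, mem_openConnIn_of_walk W ?_ ?_⟩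
  · intro x hx
    obtain ⟨s, his, hst, rfl⟩ := hWs x hx
    show dist (meshPoint δ (cornerOrbit β c s).1) z ≤ R + 2 * δ
    rcases Nat.lt_or_ge s t with hlt | hge
    · linarith [hbefore s his hlt]
    · have hs : s = t := le_antisymm hst hge
      subst hs
      rcases Nat.lt_or_ge i s with his' | his'
      · obtain ⟨s', rfl⟩ : ∃ s', s = s' + 1 := ⟨s - 1, by omega⟩
        have h1 := dist_meshPoint_cornerOrbit_succ_le β c δ s'
        have h2 := hbefore s' (by omega) (Nat.lt_succ_self s')
        have h3 := dist_triangle (meshPoint δ (cornerOrbit β c (s' + 1)).1)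
          (meshPoint δ (cornerOrbit β c s').1) z
        rw [abs_of_nonneg hδ] at h1
        linarith
      · have hs : s = i := le_antisymm his' his
        subst hs
        linarith
  · intro e he
    obtain ⟨s, -, -, rfl, hmem⟩ := hWe e he
    exact hmem

/-! ## The dual crossing on the right of a strand -/

/-- **A strand crossing an annulus is a closed (dual-open) crossing of its configuration.** Same
data as `strand_mem_annulusOpenCrossing`, with `r + 4δ ≤ R`: `β ∈ annulusDualCrossing z δ
(r + 2δ) (R - 2δ)` (the right faces up to the first exit form a walk of the dual lattice whose
steps cross edges outside `β`, from the `(r + 2δ)`-ball to distance `≥ R - 2δ`). -/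
theorem strand_mem_annulusDualCrossing (β : BondConfig (Site 2)) (c : Site 2 × Fin 4) {δ r R : ℝ}
    (hδ : 0 ≤ δ) (hrR : r + 4 * δ ≤ R) {z : ℂ} {i j : ℕ} (hij : i ≤ j)
    (hi : dist (meshPoint δ (cornerOrbit β c i).1) z ≤ r) (hj : R ≤ dist (meshPoint δ (cornerOrbit β c j).1) z) :
    β ∈ annulusDualCrossing z δ (r + 2 * δ) (R - 2 * δ) := by
  have hfar : R - 2 * δ ≤ dist (meshPoint δ (cFace (cornerOrbit β c j))) z := by
    have h1 := dist_meshPoint_cFace_le hδ (cornerOrbit β c j)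
    have h2 := dist_triangle (meshPoint δ (cornerOrbit β c j).1) (meshPoint δ (cFace (cornerOrbit β c j))) z
    rw [dist_comm] at h1
    linarith
  obtain ⟨t, hit, -, hRt, hbefore⟩ :=
    exists_firstFarIndex (fun s => dist (meshPoint δ (cFace (cornerOrbit β c s))) z) (R - 2 * δ) hij hfar
  obtain ⟨Q, hQs, hQd⟩ := exists_rightWalk β c i t hit
  have hnear : dist (meshPoint δ (cFace (cornerOrbit β c i))) z ≤ r + 2 * δ := by
    have h1 := dist_meshPoint_cFace_le hδ (cornerOrbit β c i)
    have h2 := dist_triangle (meshPoint δ (cFace (cornerOrbit β c i))) (meshPoint δ (cornerOrbit β c i).1) z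
    linarith
  show dualConfig β ∈ annulusOpenCrossing z δ (r + 2 * δ) (R - 2 * δ)
  rw [mem_annulusOpenCrossing_iff]
  refine ⟨cFace (cornerOrbit β c i), hnear, cFace (cornerOrbit β c t), hRt,
    Z2HalfPlane.dualConfig_mem_openConnIn_of_walk Q ?_ ?_⟩
  · intro f hf
    obtain ⟨s, his, hst, rfl⟩ := hQs f hf
    show dist (meshPoint δ (cFace (cornerOrbit β c s))) z ≤ R - 2 * δ + 2 * δ
    rcases Nat.lt_or_ge s t with hlt | hge
    · linarith [hbefore s his hlt]
    · have hs : s = t := le_antisymm hst hge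
      subst hs
      rcases Nat.lt_or_ge i s with his' | his'
      · obtain ⟨s', rfl⟩ : ∃ s', s = s' + 1 := ⟨s - 1, by omega⟩
        have h1 := dist_meshPoint_cFace_cornerOrbit_succ_le β c δ s'
        have h2 := hbefore s' (by omega) (Nat.lt_succ_self s')
        have h3 := dist_triangle (meshPoint δ (cFace (cornerOrbit β c (s' + 1))))
          (meshPoint δ (cFace (cornerOrbit β c s'))) z
        rw [abs_of_nonneg hδ] at h1
        linarith
      · have hs : s = i := le_antisymm his' his
        subst hs
        linarith
  · intro d hd
    obtain ⟨s, -, -, hsep, hclosed⟩ := hQd d hd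
    rw [hsep]
    exact hclosed

/-! ## The two crossings together (registered form) -/

/-- **Strands crossing an annulus are open and dual crossings of their configuration**
(registered sub-goal `ufrs_strandAnnulusCrossings` of stmt-CriticalPhenomena-11387; the bridge of
items 3–5 of the UFRS road map to the tree's crossing events): for any configuration `β`, corner
`c`, mesh `δ ≥ 0`, point `z` and stretch `O c [i, j]` from within `r` of `z` to distance `≥ R`,
`β ∈ annulusOpenCrossing z δ r R` (if `r ≤ R`) and `β ∈ annulusDualCrossing z δ (r + 2δ) (R - 2δ)`
(if `r + 4δ ≤ R`). -/
theorem ufrs_strandAnnulusCrossings : ∀ (β : BondConfig (Site 2)) (c : Site 2 × Fin 4) (δ r R : ℝ) (z : ℂ) (i j : ℕ), 0 ≤ δ → i ≤ j → dist (meshPoint δ (cornerOrbit β c i).1) z ≤ r → R ≤ dist (meshPoint δ (cornerOrbit β c j).1) z → (r ≤ R → β ∈ annulusOpenCrossing z δ r R) ∧ (r + 4 * δ ≤ R → β ∈ annulusDualCrossing z δ (r + 2 * δ) (R - 2 * δ)) :=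
  fun β c _δ _r _R _z _i _j hδ hij hi hj =>
    ⟨fun hrR => strand_mem_annulusOpenCrossing β c hδ hrR hij hi hj,
      fun h4 => strand_mem_annulusDualCrossing β c hδ h4 hij hi hj⟩

/-! ## In UFRS: strands from the collar to the ball cross every annulus around their collar end -/

/-- **Collar-to-ball strands cross annuli** (UFRS vocabulary). For a datum `E` with `0 ≤ E.δ`, a
ball `B(E.δ v, ρ)` whose centre is `2ρ`-deep in `Ω`, a stretch `O c [i, j]` of an orbit of a
configuration `β` whose vertex at time `i` is within `r` of a point `z` and whose target at time
`j` has its midpoint in the ball, where `z` is within `s` of a collar point (`infDist · Ωᶜ < 3η`):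
the stretch gives `β ∈ annulusOpenCrossing z E.δ r R` for every `R ≤ ρ - 3η - E.δ - s` with
`r ≤ R`, and `β ∈ annulusDualCrossing z E.δ (r + 2 E.δ) (R - 2 E.δ)` if moreover `r + 4 E.δ ≤ R`. -/
theorem ufrs_collarStrand_crossings {E : DiscreteDobrushin} {Ω : Set ℂ} {v x : Site 2} {ρ η r R s : ℝ}
    (hδ : 0 ≤ E.δ) (hv : 2 * ρ ≤ infDist (meshPoint E.δ v) Ωᶜ) (hx : infDist (meshPoint E.δ x) Ωᶜ < 3 * η)
    {z : ℂ} (hz : dist z (meshPoint E.δ x) ≤ s) (β : BondConfig (Site 2)) (c : Site 2 × Fin 4) {i j : ℕ}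
    (hij : i ≤ j) (hi : dist (meshPoint E.δ (cornerOrbit β c i).1) z ≤ r)
    (hj : medialPoint E.δ (cTgt (cornerOrbit β c j)) ∈ ball (meshPoint E.δ v) ρ)
    (hR : R ≤ ρ - 3 * η - E.δ - s) (hrR : r ≤ R) :
    β ∈ annulusOpenCrossing z E.δ r R ∧
      (r + 4 * E.δ ≤ R → β ∈ annulusDualCrossing z E.δ (r + 2 * E.δ) (R - 2 * E.δ)) := by
  have hfar := far_of_cTgt_mem_ball (E := E) hδ hv hx hj
  have hjz : R ≤ dist (meshPoint E.δ (cornerOrbit β c j).1) z := by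
    have := dist_triangle (meshPoint E.δ (cornerOrbit β c j).1) z (meshPoint E.δ x)
    linarith
  exact ⟨strand_mem_annulusOpenCrossing β c hδ hrR hij hi hjz,
    fun h4 => strand_mem_annulusDualCrossing β c hδ h4 hij hi hjz⟩

end

end Summit.CriticalPhenomena.CardyFormulaZ2.Cruxes.EdgePrecompact.QkzStripBoundaryArm
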